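import Literature.IUT.HodgeArakelov.GaloisPairCyclotomesCor111GenuineOfHgalois
import Literature.AnabelianGeometry.AbsoluteAnabelian.AbsTopIII.Cor110Natural
import Literature.AnabelianGeometry.EtaleTheta.DoubleUnderlineTower
import HarnessLib

/-!
# [IUTchII] Cor. 1.11: the functor `ℛ → ℱ` with ALL FOUR inputs genuine — node IUTchII:Cor1.11, the (HGAL) input := the NAMED FACT
# `AbsTopIII.Cor_1_10_iii_natural` ([AbsTopIII] Cor 1.10 (iii) with its printed functoriality, Galois side, tempered version;
# F-0396 / F-0348 retyped to printed strength, p465730) CONSUMED BY NAME — abc-iut C-R46 (c), companion 2/2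

S. Mochizuki, *Inter-universal Teichmüller theory II*, §1, Cor. 1.11, kurims manuscript (Dec. 2020) p. 49
[claim: Mochizuki2012, status: disputed] (IUTchII §1 Cor 1.11, kurims p.49); Cor. 1.10 p. 47; [AbsTopIII] = S. Mochizuki, *Topics in
absolute anabelian geometry III*, Cor. 1.10 (iii) p. 43 l. 27–30 with its functoriality clause p. 44 l. 33–34, (ii)(c) p. 42 l. 35–45
«one constructs the natural isomorphism `μ_Ẑ(G_k) ⥲ μ_Ẑ(Π_X)`» [cite: MochizukiAbsTopIII2015, Cor 1.10 (iii) p.43] — now the NAMED FACT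
`Literature.AnabelianGeometry.AbsoluteAnabelian.AbsTopIII.Cor_1_10_iii_natural` (statement-only, abc-iut-f-052 gen 5, p465730; cell
rulings C-R25 / C-R46 (a) / C-R50: FACT-LIST rows F-0396 / F-0348 retyped to printed strength, human-approved OPTION A, D-0067
exception); [EtTh] Cor. 2.18 (i) p. 60 (F-0620), §1 pp. 12–13 (the class-R origin clauses `IsEtThOrigin`, `hYcl`, `IsTateOrigin` of
abc-iut-L2; never asserted).  abc-iut cell, layer L6, node `IUTchII:Cor1.11` (TAGGED «modulo hgal», abc-iut-L6-lead §F v1.19bh (2) /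
v1.19bi (1): second companion of C-R46 (c)); seat abc-iut-C-hgal-2 (gen 0); lineage abc-iut-w4-d030 / abc-iut-w5-d145
(`GaloisPairCyclotomesCor111GenuineOfHgalois`, closers cited BY NAME, nothing restated).

PROOF-ONLY RE-CUT (0 definitions, no `Prop`-valued fact, nothing restated).  abc-iut-w4-d030's `…OfHgalois` file gives the Cor. 1.11
functor over the GENUINE monoids / twist / rigidity input / Cor. 1.10 family from the anonymous hypothesis
`hHGAL : ∀ α : Π^tp_{X̲̲} ≃ₜ* Π^tp_{X̲̲}, ∃ τ ∈ G_{ℚ_p}, ∀ x, aug (α x) = τ · aug x · τ⁻¹` ((HGAL), the ONE FACT-class anabelian input,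
ruling C-R25).  HERE `hHGAL` is SUPPLIED BY NAME: the fact `hgal : AbsTopIII.Cor_1_10_iii_natural D` under its printed hypothesis
«strictly Belyi type», rendered by the fact as `IsAlgebraic ℚ (tateJ D.qX)` and displayed here as the class-R ORIGIN DATUM `hj`
(provenance clause (O) of C-R25: `j(E_{q_v}) = j(E_F) ∈ F` at the cone's data, [IUTchI] Def. 3.1 (b)), applied to the open index-`l²`
subgroup `Π^tp_{X̲̲} = C.Huu` (the fact's `TemperedAutOverGQp D C.Huu` IS the binder, reducibly):
* `EtaleLevels.deltaX_map_eq_of_cor_1_10_iii_natural` — **(H1) DISCHARGED**: the standing binder (H1) `hΔ` («every topological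
  automorphism of `Π^tp_{X̲̲}` carries `Δ = Ker(Π^tp_{X̲̲} ↠ G_K)` onto itself», [IUTchII] Ex. 1.8 (i) «`Δ ⊆ Π` may be characterized
  group-theoretically») of the Cor. 1.11 closers FOLLOWS from the fact's (HGAL) clause (pure algebra: `Ker aug` is `Inn(τ)`-stable);
  ((C′) at every `γ` is abc-iut-w4-d030's `compatible_of_hgalois` at `hHGAL :=` the fact, cited BY NAME — not re-declared);
* **`EtaleLevels.exists_cor111FunctorCor110_familyLim_multiradiallyDefined_of_cor110iiiNatural`** (arbitrary MLF `k`, model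
  identification `ε`), **`…_of_cor110iiiNatural_ownField`** (`k := K`) and **`…_of_cor110iiiNatural_ownField_origin`** (`hZ`
  supplied at the origin) — the [IUTchII] Cor. 1.11 functor `ℛ → ℱ` EXISTS and is multiradially defined, residual BY NAME =
  {F-0620 at every level, **F-0396/F-0348 = `hgal : Cor_1_10_iii_natural D`**, `hj` (origin datum), (H2) `hq`, `IsQuotientMap toTheta`,
  `IsEtThOrigin`, `hYcl`, `IsTateOrigin`, `Prop15iii`, `hZ` (not in `_origin`)} — NO anonymous anabelian hypothesis left AND ONE
  BINDER FEWER than the `_of_hgalois` closers ((H1) `hΔ` discharged).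
HONEST FRAMING: a re-cut consumes a named fact and discharges nothing; `Cor_1_10_iii_natural` is OUR typed statement of a refereed
result ([AbsTopIII], 2015), held statement-only and bound AT the instance (relative to the interface `ThetaSetting` its universal
closure is a schema, as the fact's own docstring says); nothing here asserts anything of [IUTchII], [EtTh] or [AbsTopIII]; reductions
between residuals are not a discharge; no side is taken on [IUTchIII] Cor. 3.12; typed ≠ proved.
-/

noncomputable section

open Topology

namespace Literature.IUT.HodgeArakelov

open CategoryTheory
open Literature.AnabelianGeometry.AbsoluteAnabelian

namespace EtaleLevels

open Literature.AnabelianGeometry.EtaleTheta Literature.AnabelianGeometry.SemiGraphs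
open Literature.AnabelianGeometry.EtaleTheta.ThetaSetting
open scoped Literature.AnabelianGeometry.EtaleTheta

variable {p : ℕ} [Fact p.Prime] {D : Literature.AnabelianGeometry.EtaleTheta.ThetaSetting p}
  {E : D.EtaleThetaData} {l : ℕ} (C : E.DoubleUnderline l) (hC : D.Compat) (hS : D.Sec2Hyps)
  (hl : l.Prime) (hp2 : p ≠ 2) (hpl : p ≠ l) (hζ : ∃ ζ : D.K, IsPrimitiveRoot ζ (4 * l))
  (mods : ∀ M : ℕ+, D.CyclotomeMod l M)
  (f : contCocycles D.toTheta D.DeltaTheta C.GtpYdduu) (hf : f ∈ C.rootCocycles hC)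
  (hmods : ∀ (M M' : ℕ+) (h : (M : ℕ) ∣ (M' : ℕ)) (x : D.lDeltaTheta l),
    MuN.red p M M' h ((mods M').red x) = (mods M).red x)
  (h15 : Literature.AnabelianGeometry.EtaleTheta.ThetaSetting.Prop15iii E hC) (L : C.CuspLabels)
  (hZ : ∀ M : ℕ+, Nonempty (ModelCyclotomes.lDeltaQuot (C.rigidData (mods M) hC hS h15 L) ≃*
    Literature.IUT.HodgeTheaters.ZHat))
  (h218i : ∀ M : ℕ+, (levelRigid C hC hS mods h15 L M).Cor218_i)
  [CompactSpace (setting C hC hS hl hp2 hpl hζ mods f hf).Gk]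
  (hO : D.IsEtThOrigin)
  (hYcl : (D.DtpY.map D.toHat.toMonoidHom).topologicalClosure ≤
    D.DtpY.map D.toHat.toMonoidHom ⊔ (⁅⁅D.DeltaHat, D.DeltaHat⁆, D.DeltaHat⁆).topologicalClosure)
  (hT : D.IsTateOrigin) (hqΘ : IsQuotientMap D.toTheta)
  -- (HGAL) := THE NAMED FACT [AbsTopIII] Cor 1.10 (iii) with its printed functoriality, Galois side, tempered version (abc-iut-f-052,
  -- p465730; F-0396 / F-0348 retyped) + its printed hypothesis «strictly Belyi type» as the class-R ORIGIN DATUM `hj` (`j(E_{q_X}) ∈ ℚ̄`;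
  -- provenance clause (O) of C-R25: `j(E_{q_v}) = j(E_F) ∈ F` at the cone's data)
  (hj : IsAlgebraic ℚ (Literature.NumberTheory.EllipticCurves.tateJ D.qX))
  (hgal : Literature.AnabelianGeometry.AbsoluteAnabelian.AbsTopIII.Cor_1_10_iii_natural D)

omit [CompactSpace (setting C hC hS hl hp2 hpl hζ mods f hf).Gk] in
include hj hgal in
/-- The (HGAL) clause of the named fact `AbsTopIII.Cor_1_10_iii_natural` at `H := Π^tp_{X̲̲}`, in the binder shape of the
`…_of_hgalois` statements (the public name is `EtaleLevels.hHGAL_of_cor_1_10_iii_natural`, companion 1/2, p466250; private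
copy here so that this file does not wait on that olean). [cite: MochizukiAbsTopIII2015, Cor 1.10 (iii) p.43] -/
private theorem hHGAL_of_fact :
    ∀ α : (EtaleThetaDataOfSetting.Pi C) ≃ₜ* (EtaleThetaDataOfSetting.Pi C), ∃ τ : GQp p,
      ∀ x : EtaleThetaDataOfSetting.Pi C,
        EtaleThetaDataOfSetting.aug C (α x) = τ * EtaleThetaDataOfSetting.aug C x * τ⁻¹ :=
  hgal hj C.Huu C.isOpen_Huu ⟨by rw [C.index_Huu]; exact pow_ne_zero 2 C.l_ne_zero⟩

/-! ## (H1) «`Δ` is characteristic» DISCHARGED by the fact -/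

omit [CompactSpace (setting C hC hS hl hp2 hpl hζ mods f hf).Gk] in
/-- Membership in `Δ = Ker(Π^tp_{X̲̲} ↠ G_K)` of the [IUTchII] §1 setting of `X̲̲` is `aug(x) = 1` in `G_{ℚ_p}` (bookkeeping through
`setting = ofDoubleUnderline …`, whose augmentation is `aug ∘ C.Huu.subtype` co-restricted to `G_K ≤ G_{ℚ_p}`).
[claim: Mochizuki2012, status: disputed] (IUTchII §1 Ex 1.8 (i), kurims p.35) -/
theorem mem_deltaX_setting_iff (x : (setting C hC hS hl hp2 hpl hζ mods f hf).PiX) :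
    x ∈ (setting C hC hS hl hp2 hpl hζ mods f hf).DeltaX ↔ EtaleThetaDataOfSetting.aug C x = 1 := by
  constructor
  · intro hx
    have hx' : (setting C hC hS hl hp2 hpl hζ mods f hf).aug x = 1 := hx
    exact congrArg Subtype.val hx'
  · intro hx
    show (setting C hC hS hl hp2 hpl hζ mods f hf).aug x = 1
    exact Subtype.ext hx

omit [CompactSpace (setting C hC hS hl hp2 hpl hζ mods f hf).Gk] in
include hj hgal in
/-- **(H1) FROM THE FACT**: under [AbsTopIII] Cor. 1.10 (iii) with its printed functoriality (`AbsTopIII.Cor_1_10_iii_natural D`, BY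
NAME) and its printed hypothesis «strictly Belyi» (`hj`), EVERY topological automorphism `g` of `Π^tp_{X̲̲}` carries
`Δ = Ker(Π^tp_{X̲̲} ↠ G_K)` onto itself — since `aug ∘ g = Inn(τ) ∘ aug` ((HGAL)) and `Ker aug` is `Inn(τ)`-stable.  This is the
standing binder (H1) `hΔ` of abc-iut-w4-d030 / abc-iut-w5-d145's Cor. 1.11 closers («the subgroup `Δ ⊆ Π` … may be characterized
group-theoretically», [IUTchII] Ex. 1.8 (i)), now a COROLLARY of the named fact.  Pure algebra over (HGAL) (cf. abc-iut-w4-d014's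
`TemperedCurve.map_deltaTemp_eq_of_aug_conj` for `Π^tp_X`). [claim: Mochizuki2012, status: disputed] (IUTchII §1 Ex 1.8 (i), kurims p.35) -/
theorem deltaX_map_eq_of_cor_1_10_iii_natural :
    ∀ g : (setting C hC hS hl hp2 hpl hζ mods f hf).PiX ≃ₜ* (setting C hC hS hl hp2 hpl hζ mods f hf).PiX,
      (setting C hC hS hl hp2 hpl hζ mods f hf).DeltaX.map g.toMulEquiv.toMonoidHom =
        (setting C hC hS hl hp2 hpl hζ mods f hf).DeltaX := by
  intro g
  obtain ⟨τ, hτ⟩ := hHGAL_of_fact C hj hgal g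
  ext x
  constructor
  · rintro ⟨y, hy, rfl⟩
    have hy' := (mem_deltaX_setting_iff C hC hS hl hp2 hpl hζ mods f hf y).1 hy
    apply (mem_deltaX_setting_iff C hC hS hl hp2 hpl hζ mods f hf _).2
    show EtaleThetaDataOfSetting.aug C (g y) = 1
    have h1 : EtaleThetaDataOfSetting.aug C (g y) = τ * EtaleThetaDataOfSetting.aug C y * τ⁻¹ := hτ y
    rw [h1, hy', mul_one, mul_inv_cancel]
  · intro hx
    refine ⟨g.symm x, (mem_deltaX_setting_iff C hC hS hl hp2 hpl hζ mods f hf _).2 ?_,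
      ContinuousMulEquiv.apply_symm_apply g x⟩
    have hx' := (mem_deltaX_setting_iff C hC hS hl hp2 hpl hζ mods f hf x).1 hx
    have h1 : EtaleThetaDataOfSetting.aug C (g (g.symm x)) =
        τ * EtaleThetaDataOfSetting.aug C (g.symm x) * τ⁻¹ := hτ (g.symm x)
    have h2 : EtaleThetaDataOfSetting.aug C (g (g.symm x)) = EtaleThetaDataOfSetting.aug C x :=
      congrArg (EtaleThetaDataOfSetting.aug C) (ContinuousMulEquiv.apply_symm_apply g x)
    rw [h2, hx'] at h1
    calc EtaleThetaDataOfSetting.aug C (g.symm x)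
        = τ⁻¹ * (τ * EtaleThetaDataOfSetting.aug C (g.symm x) * τ⁻¹) * τ := by group
      _ = 1 := by rw [← h1]; group

/-! ## The Cor. 1.11 functor with all four inputs genuine, from (HGAL) alone -/

variable (k : Type) [Field k] [CharZero k] [ValuativeRel k] [TopologicalSpace k] [IsNonarchimedeanLocalField k]
  (ε : (setting C hC hS hl hp2 hpl hζ mods f hf).Gk ≃ₜ*
    (ModelMLFGaloisData.galois (MLFClosure.std k).k (MLFClosure.std k).K).tmPair.Pi)
  (hq : Nonempty (TopGroup.quot (setting C hC hS hl hp2 hpl hζ mods f hf).PiX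
    (setting C hC hS hl hp2 hpl hζ mods f hf).DeltaX ≃ₜ* (setting C hC hS hl hp2 hpl hζ mods f hf).Gk))

include hO hYcl hT hqΘ hj hgal in
/-- **[IUTchII] Cor. 1.11 with ALL inputs GENUINE, from (HGAL) alone** (arbitrary MLF `k` with a model identification `ε` of
`G_K` with `Gal(k̄/k)` of the standard closure): over the [EtTh]-model setting, with the GENUINE monoids `genuineOfModel`, the
GENUINE `Ẑ^×`-twist, the UNCONDITIONAL rigidity input and Cor. 1.10's GENUINE family `familyLim`, the Cor. 1.11 functor
`ℛ → ℱ` EXISTS and is multiradially defined — granted, beyond the printed side conditions and the class-R origin clauses, (H1)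
`hΔ`, (H2) `hq`, F-0620 at every level and (HGAL) = [AbsTopIII] Cor. 1.10 ONLY (abc-iut-w5-d145's `…_of_compatible` with its
hypothesis (C′) DISCHARGED by `compatible_of_hgalois`) — HERE with (HGAL) := the named fact `AbsTopIII.Cor_1_10_iii_natural` (+ origin
datum `hj`) and (H1) `hΔ` DISCHARGED from it (`deltaX_map_eq_of_cor_1_10_iii_natural`): residual BY NAME {F-0620, F-0396/F-0348, `hj`,
(H2) `hq`, class-R clauses}. [claim: Mochizuki2012, status: disputed] (IUTchII §1 Cor 1.11, kurims p.49) -/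
theorem exists_cor111FunctorCor110_familyLim_multiradiallyDefined_of_cor110iiiNatural
    (Γ : Subgroup ZHatUnits) (Γ' : Type) [Group Γ'] :
    ∃ (R : GalRigidityInput
        (AbsTopMonoids.genuineOfModel (setting C hC hS hl hp2 hpl hζ mods f hf) (MLFClosure.std k) ε
          (deltaX_map_eq_of_cor_1_10_iii_natural C hC hS hl hp2 hpl hζ mods f hf hj hgal) hq))
      (I : GalCorPiXInput
        (AbsTopMonoids.genuineOfModel (setting C hC hS hl hp2 hpl hζ mods f hf) (MLFClosure.std k) ε
          (deltaX_map_eq_of_cor_1_10_iii_natural C hC hS hl hp2 hpl hζ mods f hf hj hgal) hq)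
        (familyLim C hC hS hl hp2 hpl hζ mods f hf hmods h15 L hZ (h218i 1))),
      ((ex18iii (setting C hC hS hl hp2 hpl hζ mods f hf) Γ').toDagger
        (cor111FunctorCor110 (GalTwistInput.ofZHat (setting C hC hS hl hp2 hpl hζ mods f hf)) R
          (familyLim C hC hS hl hp2 hpl hζ mods f hf hmods h15 L hZ (h218i 1)) I Γ Γ')).IsMultiradiallyDefined :=
  exists_cor111FunctorCor110_familyLim_multiradiallyDefined_of_hgalois C hC hS hl hp2 hpl hζ mods f hf hmods h15 L hZ h218i
    hO hYcl hT hqΘ (hHGAL_of_fact C hj hgal) k ε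
    (deltaX_map_eq_of_cor_1_10_iii_natural C hC hS hl hp2 hpl hζ mods f hf hj hgal) hq Γ Γ'

include hO hYcl hT hqΘ hj hgal in
/-- **[IUTchII] Cor. 1.11 with ALL inputs GENUINE over the setting's OWN base field `K`, from (HGAL) alone** (`k := K ⊆ ℚ̄_p`,
`ε := TemperedCurve.galoisEpsilon`; NO model identification left): the Cor. 1.11 functor `ℛ → ℱ` over `genuineOfModel (setting …)
K.mlfClosure K.galoisEpsilon`, the genuine `Ẑ^×`-twist, the unconditional rigidity input and Cor. 1.10's genuine family EXISTS and
is multiradially defined — residual inputs BY NAME: F-0620 (every level), F-0396/F-0348 = `hgal : AbsTopIII.Cor_1_10_iii_natural D` + `hj`,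
(H2) `hq`, `IsQuotientMap toTheta`, the class-R origin clauses, `Prop15iii`, `hZ` — (HGAL) SUPPLIED by the named fact and (H1) `hΔ`
DISCHARGED from it. THE CLOSER OF RECORD for node IUTchII:Cor1.11 under rulings C-R25 / C-R46 / C-R54.
[claim: Mochizuki2012, status: disputed] (IUTchII §1 Cor 1.11, kurims p.49) -/
theorem exists_cor111FunctorCor110_familyLim_multiradiallyDefined_of_cor110iiiNatural_ownField
    (Γ : Subgroup ZHatUnits) (Γ' : Type) [Group Γ'] :
    ∃ (R : GalRigidityInput
        (AbsTopMonoids.genuineOfModel (setting C hC hS hl hp2 hpl hζ mods f hf) D.toTemperedCurve.mlfClosure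
          D.toTemperedCurve.galoisEpsilon
          (deltaX_map_eq_of_cor_1_10_iii_natural C hC hS hl hp2 hpl hζ mods f hf hj hgal) hq))
      (I : GalCorPiXInput
        (AbsTopMonoids.genuineOfModel (setting C hC hS hl hp2 hpl hζ mods f hf) D.toTemperedCurve.mlfClosure
          D.toTemperedCurve.galoisEpsilon
          (deltaX_map_eq_of_cor_1_10_iii_natural C hC hS hl hp2 hpl hζ mods f hf hj hgal) hq)
        (familyLim C hC hS hl hp2 hpl hζ mods f hf hmods h15 L hZ (h218i 1))),
      ((ex18iii (setting C hC hS hl hp2 hpl hζ mods f hf) Γ').toDagger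
        (cor111FunctorCor110 (GalTwistInput.ofZHat (setting C hC hS hl hp2 hpl hζ mods f hf)) R
          (familyLim C hC hS hl hp2 hpl hζ mods f hf hmods h15 L hZ (h218i 1)) I Γ Γ')).IsMultiradiallyDefined :=
  exists_cor111FunctorCor110_familyLim_multiradiallyDefined_of_hgalois_ownField C hC hS hl hp2 hpl hζ mods f hf hmods h15 L
    hZ h218i hO hYcl hT hqΘ (hHGAL_of_fact C hj hgal)
    (deltaX_map_eq_of_cor_1_10_iii_natural C hC hS hl hp2 hpl hζ mods f hf hj hgal) hq Γ Γ'

end EtaleLevels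

/-! ## The own-field capstone with the binder `hZ` supplied at the origin -/

namespace EtaleLevels

open Literature.AnabelianGeometry.EtaleTheta Literature.AnabelianGeometry.SemiGraphs
open Literature.AnabelianGeometry.EtaleTheta.ThetaSetting
open scoped Literature.AnabelianGeometry.EtaleTheta

variable {p : ℕ} [Fact p.Prime] {D : Literature.AnabelianGeometry.EtaleTheta.ThetaSetting p}
  {E : D.EtaleThetaData} {l : ℕ} (C : E.DoubleUnderline l) (hC : D.Compat) (hS : D.Sec2Hyps)
  (hl : l.Prime) (hp2 : p ≠ 2) (hpl : p ≠ l) (hζ : ∃ ζ : D.K, IsPrimitiveRoot ζ (4 * l))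
  (mods : ∀ M : ℕ+, D.CyclotomeMod l M)
  (f : contCocycles D.toTheta D.DeltaTheta C.GtpYdduu) (hf : f ∈ C.rootCocycles hC)
  (hmods : ∀ (M M' : ℕ+) (h : (M : ℕ) ∣ (M' : ℕ)) (x : D.lDeltaTheta l),
    MuN.red p M M' h ((mods M').red x) = (mods M).red x)
  (h15 : Literature.AnabelianGeometry.EtaleTheta.ThetaSetting.Prop15iii E hC) (L : C.CuspLabels)
  (hO : D.IsEtThOrigin)
  (hYcl : (D.DtpY.map D.toHat.toMonoidHom).topologicalClosure ≤
    D.DtpY.map D.toHat.toMonoidHom ⊔ (⁅⁅D.DeltaHat, D.DeltaHat⁆, D.DeltaHat⁆).topologicalClosure)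
  (hT : D.IsTateOrigin) (hqΘ : IsQuotientMap D.toTheta)
  (h218i : ∀ M : ℕ+, (levelRigid C hC hS mods h15 L M).Cor218_i)
  [CompactSpace (setting C hC hS hl hp2 hpl hζ mods f hf).Gk]
  (hq : Nonempty (TopGroup.quot (setting C hC hS hl hp2 hpl hζ mods f hf).PiX
    (setting C hC hS hl hp2 hpl hζ mods f hf).DeltaX ≃ₜ* (setting C hC hS hl hp2 hpl hζ mods f hf).Gk))
  (hj : IsAlgebraic ℚ (Literature.NumberTheory.EllipticCurves.tateJ D.qX))
  (hgal : Literature.AnabelianGeometry.AbsoluteAnabelian.AbsTopIII.Cor_1_10_iii_natural D)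

omit [CompactSpace (setting C hC hS hl hp2 hpl hζ mods f hf).Gk] in
include hj hgal in
/-- The (HGAL) clause of the named fact (second section's copy of the projection).
[cite: MochizukiAbsTopIII2015, Cor 1.10 (c) p.42] -/
private theorem hHGAL_of_fact' :
    ∀ α : (EtaleThetaDataOfSetting.Pi C) ≃ₜ* (EtaleThetaDataOfSetting.Pi C), ∃ τ : GQp p,
      ∀ x : EtaleThetaDataOfSetting.Pi C,
        EtaleThetaDataOfSetting.aug C (α x) = τ * EtaleThetaDataOfSetting.aug C x * τ⁻¹ :=
  hgal hj C.Huu C.isOpen_Huu ⟨by rw [C.index_Huu]; exact pow_ne_zero 2 C.l_ne_zero⟩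

include hT hqΘ hj hgal in
/-- **The same over `K`, with `hZ` SUPPLIED**: at an [EtTh] origin the binder `hZ` («(l·Δ_Θ)/thetaKer ≅ Ẑ» at every level,
G-w4d021-1) IS abc-iut-L2-d1's theorem `ModelCyclotomes.nonempty_lDeltaQuot_rigidData_mulEquiv_zHat … hO hYcl` (p415192), so the
Cor. 1.11 functor over `K` exists and is multiradially defined with the residual list of
`…_of_hgalois_ownField` MINUS `hZ`. [claim: Mochizuki2012, status: disputed] (IUTchII §1 Cor 1.11, kurims p.49) -/
theorem exists_cor111FunctorCor110_familyLim_multiradiallyDefined_of_cor110iiiNatural_ownField_origin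
    (Γ : Subgroup ZHatUnits) (Γ' : Type) [Group Γ'] :
    ∃ (R : GalRigidityInput
        (AbsTopMonoids.genuineOfModel (setting C hC hS hl hp2 hpl hζ mods f hf) D.toTemperedCurve.mlfClosure
          D.toTemperedCurve.galoisEpsilon
          (deltaX_map_eq_of_cor_1_10_iii_natural C hC hS hl hp2 hpl hζ mods f hf hj hgal) hq))
      (I : GalCorPiXInput
        (AbsTopMonoids.genuineOfModel (setting C hC hS hl hp2 hpl hζ mods f hf) D.toTemperedCurve.mlfClosure
          D.toTemperedCurve.galoisEpsilon
          (deltaX_map_eq_of_cor_1_10_iii_natural C hC hS hl hp2 hpl hζ mods f hf hj hgal) hq)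
        (familyLim C hC hS hl hp2 hpl hζ mods f hf hmods h15 L
          (fun M => ModelCyclotomes.nonempty_lDeltaQuot_rigidData_mulEquiv_zHat C (mods M) hC hS h15 L hO hYcl hl.ne_zero)
          (h218i 1))),
      ((ex18iii (setting C hC hS hl hp2 hpl hζ mods f hf) Γ').toDagger
        (cor111FunctorCor110 (GalTwistInput.ofZHat (setting C hC hS hl hp2 hpl hζ mods f hf)) R
          (familyLim C hC hS hl hp2 hpl hζ mods f hf hmods h15 L
            (fun M => ModelCyclotomes.nonempty_lDeltaQuot_rigidData_mulEquiv_zHat C (mods M) hC hS h15 L hO hYcl hl.ne_zero)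
            (h218i 1)) I Γ Γ')).IsMultiradiallyDefined :=
  exists_cor111FunctorCor110_familyLim_multiradiallyDefined_of_hgalois_ownField_origin C hC hS hl hp2 hpl hζ mods f hf
    hmods h15 L hO hYcl hT hqΘ h218i
    (deltaX_map_eq_of_cor_1_10_iii_natural C hC hS hl hp2 hpl hζ mods f hf hj hgal) hq (hHGAL_of_fact' C hj hgal) Γ Γ'

end EtaleLevels

end Literature.IUT.HodgeArakelov

end
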